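import Mathlib.Data.List.GetD
import Summits.Ventures.QEC.Census.CertBits
import HarnessLib

/-!
# Word-level check for «one row-list matrix is another re-indexed along explicit bijection tables»
# (qec census EQUIV lane, qec-search-1; support module for `Census/Equiv/*.lean`)

The EQUIV lane (lead block 160 (3) / FINDINGS T-89) proves `C'.HX = C.HX.submatrix ρ σ` for two census codes given as
row lists (`rowMatrix n L'`, `rowMatrix n' L`) and explicit permutation TABLES `σtab` (qubits) and `ρtab` (check rows), then
transports `IsCode` by FACT P (`CSSCode.isCode_iff_of_submatrix`, Lin–Pryadko 2024 Thm 6). Deciding the matrix identity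
entrywise in the kernel costs `|L'| · n` table look-ups (minutes at `n ≈ 200`); this file replaces it by ONE pass per row:
`gatherBits σtab w` is the word whose bit `q` is bit `σtab[q]` of `w` (structural recursion, like `colMask`), and
`permRowsOK n n' L' L σtab ρtab` checks `L'[i] = gatherBits σtab L[ρtab[i]]` for every row together with the range side
conditions; `rowMatrix_eq_submatrix_of_permRowsOK` turns a passing check into the matrix identity for ANY functions `σ`, `ρ`
whose values are read from the tables. All folklore bit arithmetic; no `native_decide`; nothing about codes is asserted here.
-/

namespace Summit.Ventures.QEC.Census

open Matrix

/-- `gatherBits tab w`: the word whose bit `q` (`q < tab.length`) is bit `tab[q]` of `w`. (definition, structural on the table) -/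
def gatherBits : List ℕ → ℕ → ℕ
  | [], _ => 0
  | t :: ts, w => (if w.testBit t then 1 else 0) + 2 * gatherBits ts w

/-- bit `q` of `gatherBits tab w` is bit `tab[q]` of `w`. -/
theorem testBit_gatherBits (tab : List ℕ) (w q : ℕ) (hq : q < tab.length) :
    (gatherBits tab w).testBit q = w.testBit tab[q] := by
  induction tab generalizing q with
  | nil => simp at hq
  | cons t ts ih =>
    cases q with
    | zero =>
      rw [gatherBits, Nat.testBit_zero]
      split <;> simp_all [Nat.add_mul_mod_self_left]
    | succ q =>
      rw [gatherBits, Nat.testBit_succ]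
      have hq' : q < ts.length := by simpa using hq
      have : ((if w.testBit t then 1 else 0) + 2 * gatherBits ts w) / 2 = gatherBits ts w := by
        split <;> omega
      rw [this, ih q hq']
      simp

/-- `permRowsOK n n' L' L σtab ρtab`: the qubit table has length `n` with entries `< n'`, the row table has an entry `< |L|` for
every row of `L'`, and every row of `L'` is the gathered row of `L`: `L'[i] = gatherBits σtab L[ρtab[i]]`. (definition, `decide +kernel`) -/
def permRowsOK (n n' : ℕ) (L' L σtab ρtab : List ℕ) : Bool :=
  (σtab.length == n) && σtab.all (· < n') && (ρtab.length == L'.length) && ρtab.all (· < L.length) &&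
    (List.range L'.length).all fun i => L'.getD i 0 == gatherBits σtab (L.getD (ρtab.getD i 0) 0)

/-- **A passing `permRowsOK` check IS the matrix identity** `rowMatrix n L' = (rowMatrix n' L).submatrix ρ σ` for every pair of
functions reading the tables (`(σ q).val = σtab[q]`, `(ρ i).val = ρtab[i]`, stated with `getD … % …` as the Equiv files define them). -/
theorem rowMatrix_eq_submatrix_of_permRowsOK {n n' : ℕ} {L' L σtab ρtab : List ℕ}
    (h : permRowsOK n n' L' L σtab ρtab = true)
    (σ : Fin n → Fin n') (ρ : Fin L'.length → Fin L.length)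
    (hσ : ∀ q : Fin n, (σ q).val = σtab.getD q.val 0 % n')
    (hρ : ∀ i : Fin L'.length, (ρ i).val = ρtab.getD i.val 0 % L.length) :
    rowMatrix n L' = (rowMatrix n' L).submatrix ρ σ := by
  simp only [permRowsOK, Bool.and_eq_true, beq_iff_eq, List.all_eq_true, decide_eq_true_eq, List.mem_range] at h
  obtain ⟨⟨⟨⟨hσlen, hσlt⟩, hρlen⟩, hρlt⟩, hrows⟩ := h
  ext i q
  have hi : i.val < L'.length := i.isLt
  have hqσ : q.val < σtab.length := by rw [hσlen]; exact q.isLt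
  have hiρ : i.val < ρtab.length := by rw [hρlen]; exact hi
  have hσq : σtab.getD q.val 0 = σtab[q.val] := List.getD_eq_getElem _ _ hqσ
  have hρi : ρtab.getD i.val 0 = ρtab[i.val] := List.getD_eq_getElem _ _ hiρ
  have hσq_lt : σtab[q.val] < n' := hσlt _ (List.getElem_mem hqσ)
  have hρi_lt : ρtab[i.val] < L.length := hρlt _ (List.getElem_mem hiρ)
  have hσv : (σ q).val = σtab[q.val] := by rw [hσ q, hσq, Nat.mod_eq_of_lt hσq_lt]
  have hρv : (ρ i).val = ρtab[i.val] := by rw [hρ i, hρi, Nat.mod_eq_of_lt hρi_lt]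
  have hrow := hrows i.val hi
  have e1 : L'[i] = L'.getD i.val 0 := (List.getD_eq_getElem _ _ hi).symm
  have e2 : L[ρ i] = L.getD (ρ i).val 0 := (List.getD_eq_getElem _ _ (ρ i).isLt).symm
  have hbit : L'[i].testBit q.val = L[ρ i].testBit (σ q).val := by
    rw [e1, e2, hrow, testBit_gatherBits _ _ _ hqσ, hσv, hρv, hρi]
  change (if L'[i].testBit q.val then (1 : ZMod 2) else 0) = (if L[ρ i].testBit (σ q).val then (1 : ZMod 2) else 0)
  simp only [hbit]

end Summit.Ventures.QEC.Census
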